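import Summits.QuantumFields.BalabanUV.Beta.EriceFlowEnclosureB12AsPrintedPointwiseFadingOrder
import Literature.MathematicalPhysics.QuantumFieldTheory.Balaban1983to89.T4TwoRunUniqueness

/-!
# Beta / EriceFlowEnclosureB12AsPrintedPointwiseFadingOrderSharp — WHAT (0.31) FORCES POINTWISE, part 7♯: THE SHARP BOX FOR SIGN-FREE ORDER UNDER
# FADING MEMORY.  Part 7 (`…PointwiseFadingOrder`, gen 44) read the same-length discrepancy recursion of two runs of (0.20) FORWARD and SIGNED and found
# that under node U2's coupling-chart moduli `HistLipschitz Λ γ β` + `FadingMemory C θ Λ` (0 ≤ θ < 1) the ORDER of the couplings — hence uniqueness of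
# «g₀ = g₀(ε, g)» — is FREE (no asymptotic freedom, no sign, no Theorem 2) in every box with `4Cγ³ ≤ (1 − θ)²`, the discrepancy contracting no faster
# than (1 + θ)∕2 per step.  This module re-runs the argument with the two slack factors removed: (i) node U2's SYMMETRIC chart bound
# |g − g′| ≤ (γ³∕2)·|1∕g² − 1∕g′²| (`T4TwoRunUniqueness.abs_sub_le_half_cube`, BY NAME) in place of the one-sided `abs_sub_le_of_inv_sq` (weight g²g′ ≤ γ³),
# and (ii) the OPTIMAL comparison ratio: the chain Δ_{k+1} ≥ ρΔ_k propagates through the fading feedback as soon as (Cγ³∕2)·ρ∕(ρ − θ) ≤ 1 − ρ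
# (**`sep_geometric_ratio`**, any θ < ρ), and (1 − ρ)(ρ − θ)∕ρ is maximal at ρ = √θ with value (1 − √θ)².  RESULT: ORDER at every scale, STRICT
# MONOTONICITY of the endpoint map and the separation RATE Δ_j ≥ (√θ)^j Δ_0 hold SIGN-FREE in every box with
#                                             **C γ³ ≤ 2 (1 − √θ)²**            (ratio √θ; **`sep_geometric_sqrt`**, 0 < θ < 1),
# and at θ = 0 (last-only moduli) in every box with **Cγ³ < 2** (ratio 1 − Cγ³∕2; **`sep_geometric_markov`**).  JUNCTION WITH NODE U2: for UNIQUENESS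
# (not order) this box is ALREADY node U2's — `T4TwoRunUniqueness.eq_of_pin_fadingMemory_rho` (backward weighted maximum M = max δ_iρ^i, smallness
# (Cγ³∕2)ρ < (1 − ρθ)(ρ − 1)) read at ρ = 1∕√θ is exactly Cγ³ < 2(1 − √θ)² (**`runs_eq_of_fadingMemory_sqrt_U2`**, 6 lines), and its regime (ii)
# `eq_of_pin_lastOnly` is the Markov edge Lγ³ < 2; what is added here is the ORDER ∕ RATE form (forward, signed) at the same edge, the instantiation
# ρ = √θ, and the carrier END (companion `…SharpEnd`).  So BOTH comparison methods — backward weighted maximum and forward ratio — stop at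
# Cγ³ = 2(1 − √θ)², prover 1's conjectured asymptotics «≍ 2(1 − √θ)²» for the sharp threshold t(θ) of REFERENCE-FREE uniqueness (bflow-p1 gen 35
# `g35/NEXT-TOUCH.md` (A): «(1−θ)²∕4 ≤ t(θ) (prover 2, gen 44) and t(½) ≤ 3∕2 (#63f)»; the lower side is t(θ) ≥ 2(1 − √θ)²: at θ = ½, 0.0625 → 0.1716);
# the companion `…FadingOrderSharpOscillation` shows why: above (1 − √θ)² (in units of Cγ³∕2) the adversarial comparison recursion
# Δ_{k+2} = (1 + θ − c)Δ_{k+1} − θΔ_k has complex characteristic roots and cannot stay positive.  Part 7's hypothesis implies this one (`smallness_of_gen44`)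
# (β-flow team, prover 2 = lower ∕ positivity side, unit `b2b-balaban-beta-bflow-p2`, gen 45; ROW AP-I × node U2's letters and `T4TwoRunUniqueness` §3 (i)∕(ii))

HONEST FRAMING (page 1 of everything the β sub-cell writes): discharging `BetaPertH` makes Bałaban's UV stability UNCONDITIONAL — a
real constructive-QFT result; it is NOT the continuum limit and NOT the Clay problem.  HONEST DEPENDENCY (cell reorg 2026-08-19,
verbatim): «continuum YM on T⁴ ⇐ BetaPertH ∧ nine spine estimates (0/9 proved); BetaPertH ⇐ (D1) ∧ (D4) ∧ CAP+tail; G-an2-4 gates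
asym, D1 and NE2/3/4.»  THIS MODULE DISCHARGES NOTHING: it is elementary real analysis about two real sequences obeying the recursion
(0.20) of [I] = T. Bałaban, Commun. Math. Phys. **109** (1987) [Balaban1987RG1] p. 256 for an ABSTRACT history-dependent family `β : FlowStep.HBeta`
(p. 298: β_j *"depends also on all preceding coupling constants"*) under node U2's HYPOTHESIS SHAPES `HistLipschitz` ∕ `FadingMemory` — NOT printed
(GAPS G-t4-U2-2).  Uniqueness of g₀ is NOT printed in [I] (custodian's `beta/asprinted/DELTA-I.md` D-21: Theorem 2 is an existence statement, the
tree types `∃`); where it holds it is the consumer's theorem under the consumer's modulus — here: the fading-memory moduli ALONE, in the sharp box.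

THE POINT.  Subtracting (0.20) for two same-length runs g, g′ ⊂ ]0, γ] gives Δ_{k+1} = Δ_k − (β_{k+1}(g_{≤k}) − β_{k+1}(g′_{≤k})), Δ_j := 1∕g_j² − 1∕g′_j²,
and the moduli bound the bracket by Σ_{i≤k} Cθ^{k−i}|g_i − g′_i| ≤ (Cγ³∕2) Σ_{i≤k} θ^{k−i}|Δ_i|.  If Δ_{i+1} ≥ ρΔ_i below k and Δ_0 > 0 then
0 < Δ_i ≤ ρ^{−(k−i)}Δ_k and the feedback is ≤ (Cγ³∕2)Δ_k Σ_d (θ∕ρ)^d ≤ (Cγ³∕2)Δ_k·ρ∕(ρ − θ); so the link Δ_{k+1} ≥ ρΔ_k closes as soon as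
(Cγ³∕2)·ρ∕(ρ − θ) ≤ 1 − ρ (`sep_geometric_ratio`, strong induction as in part 7).  The admissible c = Cγ³∕2 is (1 − ρ)(ρ − θ)∕ρ = 1 + θ − ρ − θ∕ρ, maximal
at ρ = √θ: c ≤ (1 − √θ)² — the same function of ρ′ = 1∕ρ as node U2's (1 − ρ′θ)(ρ′ − 1)∕ρ′, whence the same edge.

WHAT THIS FILE PROVES (0 sorry, 0 def; any `β : HBeta`): `signed_step_half`, **`sep_geometric_ratio`** (master link, explicit ratio), `lower_of_ratio`,
`order_of_ratio`, `runs_eq_of_ratio`, **`sep_geometric_sqrt`** (ratio √θ in the box Cγ³ ≤ 2(1−√θ)²), **`order_preserved_sqrt`**, **`runs_eq_of_fadingMemory_sqrt`**,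
`runs_eq_of_fadingMemory_sqrt_U2` (the same box from node U2's kernel at ρ = 1∕√θ), `bare_lt_iff_end_lt_sqrt`, **`sep_geometric_markov`** ∕ **`order_preserved_markov`**
(θ = 0, Cγ³ < 2; uniqueness there is node U2's `eq_of_pin_lastOnly`), `smallness_of_gen44` (part 7's box lies inside this one).  Carrier END: companion `…SharpEnd`.
NOT CLAIMED: any modulus, sign or bound for Bałaban's β; that 2(1−√θ)² is the sharp threshold for UNIQUENESS or ORDER among all families (it is the edge
of both comparison METHODS — companion module; prover 1's folds #63d∕#63f are the data from above); which reading print intends; Theorem 2; `BetaPertH`;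
continuum; Clay.
-/

namespace Summit.QuantumFields.BalabanUV.Beta.EriceFlowEnclosureB12AsPrintedPointwiseFadingOrderSharp

open Finset
open Literature.MathematicalPhysics.QuantumFieldTheory.Balaban1983to89
open Literature.MathematicalPhysics.QuantumFieldTheory.Balaban1983to89.FlowStep (HBeta prefixOf Box mem_box RGEqH)
open Literature.MathematicalPhysics.QuantumFieldTheory.Balaban1983to89.T4CouplingMatching (HistLipschitz FadingMemory)
open Literature.MathematicalPhysics.QuantumFieldTheory.Balaban1983to89.T4TwoRunUniqueness (abs_sub_le_half_cube eq_of_pin_fadingMemory_rho)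
open Summit.QuantumFields.BalabanUV.Beta.EriceFlowEnclosureB12AsPrintedHistoryUniqueMono (geom_tail_le)
open Summit.QuantumFields.BalabanUV.Beta.EriceFlowEnclosureB12AsPrintedPointwiseFadingOrder (le_of_chain fwd_unique)

noncomputable section

/-! ## §1 Two same-length runs of (0.20) for ANY history-dependent β: the sharp forward separation -/

section General

variable {β : HBeta}

/-- **THE SIGNED SAME-LENGTH STEP WITH THE SYMMETRIC WEIGHT.**  Two runs g, g′ of (0.20) for the same history-dependent β, K steps, couplings in ]0, γ],
moduli `HistLipschitz Λ γ β` (Λ ≥ 0): with Δ_j := 1∕g_j² − 1∕g′_j², for j < K, `Δ_j − Σ_{i≤j} Λ j i·(γ³∕2)·|Δ_i| ≤ Δ_{j+1}` — part 7's `signed_step` with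
node U2's symmetric
`T4TwoRunUniqueness.abs_sub_le_half_cube` in place of its one-sided `abs_sub_le_of_inv_sq`. [cite: Balaban1987RG1, (0.20) p.256 with p.298] -/
theorem signed_step_half {γ : ℝ} {Λ : ℕ → ℕ → ℝ} {K : ℕ} {g g' : ℕ → ℝ}
    (hg : RGEqH K β g) (hg' : RGEqH K β g')
    (hbox : ∀ i, i ≤ K → 0 < g i ∧ g i ≤ γ) (hbox' : ∀ i, i ≤ K → 0 < g' i ∧ g' i ≤ γ)
    (hL : HistLipschitz Λ γ β) (hΛ : ∀ k i, i ≤ k → 0 ≤ Λ k i) {j : ℕ} (hj : j < K) :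
    (1 / (g j) ^ 2 - 1 / (g' j) ^ 2)
        - ∑ i ∈ range (j + 1), Λ j i * (γ ^ 3 / 2) * |1 / (g i) ^ 2 - 1 / (g' i) ^ 2|
      ≤ 1 / (g (j + 1)) ^ 2 - 1 / (g' (j + 1)) ^ 2 := by
  have e := hg j hj
  have e' := hg' j hj
  have hp : prefixOf g j ∈ Box γ j := T4CouplingMatching.prefixOf_mem_box hj.le hbox
  have hp' : prefixOf g' j ∈ Box γ j := T4CouplingMatching.prefixOf_mem_box hj.le hbox'
  have h2 := hL j (prefixOf g j) (prefixOf g' j) hp hp'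
  have h3 : ∑ i : Fin (j + 1), Λ j i * |prefixOf g j i - prefixOf g' j i|
      ≤ ∑ i ∈ range (j + 1), Λ j i * (γ ^ 3 / 2) * |1 / (g i) ^ 2 - 1 / (g' i) ^ 2| := by
    rw [Finset.sum_range (fun i => Λ j i * (γ ^ 3 / 2) * |1 / (g i) ^ 2 - 1 / (g' i) ^ 2|)]
    refine Finset.sum_le_sum fun i _ => ?_
    have hiK : (i : ℕ) ≤ K := by have := i.isLt; omega
    simp only [FlowStep.prefixOf_apply]
    rw [mul_assoc]
    exact mul_le_mul_of_nonneg_left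
      (abs_sub_le_half_cube (hbox i hiK).1 (hbox i hiK).2 (hbox' i hiK).1 (hbox' i hiK).2)
      (hΛ j i (Nat.lt_succ_iff.mp i.isLt))
  have key : 1 / g (j + 1) ^ 2 - 1 / g' (j + 1) ^ 2
      = (1 / g j ^ 2 - 1 / g' j ^ 2) - (β j (prefixOf g j) - β j (prefixOf g' j)) := by
    rw [e, e']; ring
  rw [key]
  have h4 := (le_abs_self (β j (prefixOf g j) - β j (prefixOf g' j))).trans (h2.trans h3)
  linarith

/-- **THE MASTER LINK — FORWARD GEOMETRIC SEPARATION AT A PRESCRIBED RATIO.**  Two runs g, g′ of (0.20) (`RGEqH K β`) of the SAME length K for one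
history-dependent β, couplings in ]0, γ], coupling-chart moduli `HistLipschitz Λ γ β` with `FadingMemory C θ Λ` (0 ≤ θ, 0 ≤ C), and a ratio ρ > θ with
the closing condition `(Cγ³∕2)·ρ∕(ρ − θ) ≤ 1 − ρ`: if g_0 < g′_0 then `ρ·(1∕g_j² − 1∕g′_j²) ≤ 1∕g_{j+1}² − 1∕g′_{j+1}²` for every j < K.  (Strong induction on
the chain: below step k it gives 0 < Δ_i ≤ ρ^{−(k−i)}Δ_k, so the fading feedback Σ_{i≤k} Cθ^{k−i}(γ³∕2)|Δ_i| is ≤ (Cγ³∕2)Δ_k∕(1 − θ∕ρ) ≤ (1 − ρ)Δ_k.)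
The admissible values (1 − ρ)(ρ − θ)∕ρ of Cγ³∕2 are maximised at ρ = √θ (`sep_geometric_sqrt`); ρ = (1 + θ)∕2 is part 7's `sep_geometric`; θ = 0,
ρ = 1 − Cγ³∕2 is `sep_geometric_markov`.  NO asymptotic freedom, NO sign of β, NO upper bound, ANY depth K. [cite: Balaban1987RG1, (0.20) p.256 with p.298] -/
theorem sep_geometric_ratio {γ θ C ρ : ℝ} {Λ : ℕ → ℕ → ℝ} {K : ℕ} {g g' : ℕ → ℝ}
    (hθ0 : 0 ≤ θ) (hθρ : θ < ρ) (hC : 0 ≤ C) (hg : RGEqH K β g) (hg' : RGEqH K β g')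
    (hbox : ∀ i, i ≤ K → 0 < g i ∧ g i ≤ γ) (hbox' : ∀ i, i ≤ K → 0 < g' i ∧ g' i ≤ γ)
    (hL : HistLipschitz Λ γ β) (hΛ : FadingMemory C θ Λ)
    (hkey : C * γ ^ 3 / 2 * (ρ / (ρ - θ)) ≤ 1 - ρ) (h0 : g 0 < g' 0) :
    ∀ j, j < K → ρ * (1 / (g j) ^ 2 - 1 / (g' j) ^ 2) ≤ 1 / (g (j + 1)) ^ 2 - 1 / (g' (j + 1)) ^ 2 := by
  set Δ : ℕ → ℝ := fun j => 1 / (g j) ^ 2 - 1 / (g' j) ^ 2 with hΔ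
  clear_value Δ
  have hρpos : 0 < ρ := lt_of_le_of_lt hθ0 hθρ
  have hq0 : 0 ≤ θ / ρ := div_nonneg hθ0 hρpos.le
  have hq1 : θ / ρ < 1 := (div_lt_one hρpos).mpr hθρ
  have hg0 := hbox 0 (Nat.zero_le _)
  have hγ : 0 ≤ γ := le_trans hg0.1.le hg0.2
  have hCγ : 0 ≤ C * γ ^ 3 / 2 := by positivity
  have hne : ρ - θ ≠ 0 := (sub_pos.mpr hθρ).ne'
  have hgeom : 1 / (1 - θ / ρ) = ρ / (ρ - θ) := by
    rw [show 1 - θ / ρ = (ρ - θ) / ρ by field_simp, one_div_div]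
  -- Δ_0 > 0
  have hΔ0 : 0 < Δ 0 := by
    have := one_div_lt_one_div_of_lt (pow_pos hg0.1 2) (sq_lt_sq' (by linarith [hg0.1, (hbox' 0 (Nat.zero_le _)).1]) h0)
    simp only [hΔ]; linarith
  -- the chain up to n, for every n ≤ K
  have main : ∀ n, n ≤ K → ∀ j, j < n → ρ * Δ j ≤ Δ (j + 1) := by
    intro n
    induction n with
    | zero => intro _ j hj; exact absurd hj (Nat.not_lt_zero _)
    | succ n ih =>
      intro hn j hj
      have hnK : n < K := Nat.lt_of_succ_le hn
      have hch : ∀ j, j < n → ρ * Δ j ≤ Δ (j + 1) := ih hnK.le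
      rcases lt_or_eq_of_le (Nat.lt_succ_iff.mp hj) with hjn | rfl
      · exact hch j hjn
      · -- the new link ρ Δ_j ≤ Δ_{j+1}
        have hdom : ∀ i, i ≤ j → ρ ^ (j - i) * Δ i ≤ Δ j := le_of_chain hρpos.le j hch
        have hΔj : 0 < Δ j := lt_of_lt_of_le (mul_pos (pow_pos hρpos _) hΔ0) (hdom 0 (Nat.zero_le _))
        have hterm : ∀ i ∈ range (j + 1),
            Λ j i * (γ ^ 3 / 2) * |Δ i| ≤ C * γ ^ 3 / 2 * Δ j * (θ / ρ) ^ (j + 1 - 1 - i) := by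
          intro i hi
          have hij : i ≤ j := Nat.lt_succ_iff.mp (mem_range.mp hi)
          have hΔi : 0 < Δ i := lt_of_lt_of_le (mul_pos (pow_pos hρpos _) hΔ0)
            (le_of_chain hρpos.le i (fun l hl => hch l (lt_of_lt_of_le hl hij)) 0 (Nat.zero_le _))
          have hpowpos : 0 < ρ ^ (j - i) := pow_pos hρpos _
          have hΔi_le : Δ i ≤ Δ j / ρ ^ (j - i) := by
            rw [le_div_iff₀ hpowpos, mul_comm]; exact hdom i hij
          have hΛi := hΛ j i hij
          rw [abs_of_pos hΔi, show j + 1 - 1 - i = j - i by omega]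
          calc Λ j i * (γ ^ 3 / 2) * Δ i
              ≤ C * θ ^ (j - i) * (γ ^ 3 / 2) * (Δ j / ρ ^ (j - i)) :=
                mul_le_mul (mul_le_mul_of_nonneg_right hΛi.2 (by positivity)) hΔi_le hΔi.le (by positivity)
            _ = C * γ ^ 3 / 2 * Δ j * (θ / ρ) ^ (j - i) := by
                rw [div_pow]; ring
        have hsum : ∑ i ∈ range (j + 1), Λ j i * (γ ^ 3 / 2) * |Δ i|
            ≤ C * γ ^ 3 / 2 * (ρ / (ρ - θ)) * Δ j := by
          calc ∑ i ∈ range (j + 1), Λ j i * (γ ^ 3 / 2) * |Δ i|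
              ≤ ∑ i ∈ range (j + 1), C * γ ^ 3 / 2 * Δ j * (θ / ρ) ^ (j + 1 - 1 - i) := Finset.sum_le_sum hterm
            _ = C * γ ^ 3 / 2 * Δ j * ∑ i ∈ range (j + 1), (θ / ρ) ^ (j + 1 - 1 - i) := by rw [← Finset.mul_sum]
            _ = C * γ ^ 3 / 2 * Δ j * ∑ i ∈ range (j + 1), (θ / ρ) ^ i := by
                rw [Finset.sum_range_reflect (fun i => (θ / ρ) ^ i) (j + 1)]
            _ ≤ C * γ ^ 3 / 2 * Δ j * (1 / (1 - θ / ρ)) := by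
                refine mul_le_mul_of_nonneg_left ?_ (mul_nonneg hCγ hΔj.le)
                have h := geom_tail_le hq0 hq1 0 (j + 1)
                simp only [Nat.Ico_zero_eq_range, Nat.sub_zero] at h
                exact h
            _ = C * γ ^ 3 / 2 * (ρ / (ρ - θ)) * Δ j := by rw [hgeom]; ring
        have hstep := signed_step_half hg hg' hbox hbox' hL (fun k i hik => (hΛ k i hik).1) hnK
        have hprod : C * γ ^ 3 / 2 * (ρ / (ρ - θ)) * Δ j ≤ (1 - ρ) * Δ j :=
          mul_le_mul_of_nonneg_right hkey hΔj.le
        simp only [hΔ] at hsum hprod hΔj ⊢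
        nlinarith [hstep, hsum, hprod]
  intro j hj
  have h := main K le_rfl j hj
  simp only [hΔ] at h
  exact h

/-- A positive-ratio chain integrates from the bare end: `ρ ≥ 0` and `ρΔ_j ≤ Δ_{j+1}` for j < K give `ρ^j·Δ_0 ≤ Δ_j` for j ≤ K (part 7's `le_of_chain` read at
i = 0). [folklore] -/
theorem lower_of_ratio {ρ : ℝ} {K : ℕ} {Δ : ℕ → ℝ} (hρ : 0 ≤ ρ)
    (hch : ∀ j, j < K → ρ * Δ j ≤ Δ (j + 1)) {j : ℕ} (hj : j ≤ K) : ρ ^ j * Δ 0 ≤ Δ j := by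
  have h := le_of_chain hρ j (fun i hi => hch i (lt_of_lt_of_le hi hj)) 0 (Nat.zero_le _)
  simpa using h

/-- **FROM A POSITIVE RATIO TO ORDER AT EVERY SCALE.**  Two positive coupling sequences with g_0 < g′_0 whose discrepancies 1∕g_j² − 1∕g′_j² obey a chain with
ratio ρ > 0 up to K satisfy g_j < g′_j for every j ≤ K. [folklore] -/
theorem order_of_ratio {ρ : ℝ} {K : ℕ} {g g' : ℕ → ℝ} (hρ : 0 < ρ)
    (hpos : ∀ i, i ≤ K → 0 < g i) (hpos' : ∀ i, i ≤ K → 0 < g' i) (h0 : g 0 < g' 0)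
    (hch : ∀ j, j < K → ρ * (1 / (g j) ^ 2 - 1 / (g' j) ^ 2) ≤ 1 / (g (j + 1)) ^ 2 - 1 / (g' (j + 1)) ^ 2) :
    ∀ j, j ≤ K → g j < g' j := by
  intro j hj
  have hg0 := hpos 0 (Nat.zero_le _)
  have hgj := hpos j hj
  have hgj' := hpos' j hj
  have hΔ0 : 0 < 1 / (g 0) ^ 2 - 1 / (g' 0) ^ 2 := by
    linarith [one_div_lt_one_div_of_lt (pow_pos hg0 2) (sq_lt_sq' (by linarith [hpos' 0 (Nat.zero_le _)]) h0)]
  have h := lower_of_ratio (Δ := fun j => 1 / (g j) ^ 2 - 1 / (g' j) ^ 2) hρ.le hch hj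
  have hpos2 : 0 < 1 / (g j) ^ 2 - 1 / (g' j) ^ 2 :=
    lt_of_lt_of_le (mul_pos (pow_pos hρ j) hΔ0) h
  have hsq : (g j) ^ 2 < (g' j) ^ 2 := (one_div_lt_one_div (pow_pos hgj' 2) (pow_pos hgj 2)).mp (by linarith)
  have := abs_lt_of_sq_lt_sq hsq hgj'.le
  rwa [abs_of_pos hgj] at this

/-- **FROM ORDER TO SAME-LENGTH UNIQUENESS** (any β): if every ordered pair of positive in-box runs of (0.20) of length K stays ordered up to K, then two such
runs PINNED at g_K = g′_K coincide at every scale — trichotomy on the bare couplings + part 7's `fwd_unique`. [cite: Balaban1987RG1, Thm 2 p.259 («g₀ = g₀(ε, g)») with (0.20) p.256] -/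
theorem runs_eq_of_ratio {γ : ℝ} {K : ℕ} {g g' : ℕ → ℝ} (hg : RGEqH K β g) (hg' : RGEqH K β g')
    (hbox : ∀ i, i ≤ K → 0 < g i ∧ g i ≤ γ) (hbox' : ∀ i, i ≤ K → 0 < g' i ∧ g' i ≤ γ)
    (hord : ∀ h h' : ℕ → ℝ, RGEqH K β h → RGEqH K β h' → (∀ i, i ≤ K → 0 < h i ∧ h i ≤ γ) → (∀ i, i ≤ K → 0 < h' i ∧ h' i ≤ γ) →
      h 0 < h' 0 → ∀ j, j ≤ K → h j < h' j)
    (hpin : g K = g' K) : ∀ j, j ≤ K → g j = g' j := by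
  rcases lt_trichotomy (g 0) (g' 0) with hlt | heq | hgt
  · exact absurd hpin (ne_of_lt (hord g g' hg hg' hbox hbox' hlt K le_rfl))
  · exact fwd_unique hg hg' (fun i hi => (hbox i hi).1) (fun i hi => (hbox' i hi).1) heq
  · exact absurd hpin.symm (ne_of_lt (hord g' g hg' hg hbox' hbox hgt K le_rfl))

/-- **FORWARD GEOMETRIC SEPARATION IN THE SHARP BOX — RATIO √θ.**  Two runs g, g′ of (0.20) of the SAME length K for one history-dependent β, couplings in
]0, γ], moduli `HistLipschitz Λ γ β` with `FadingMemory C θ Λ`, 0 < θ < 1, 0 ≤ C, and the box smallness **`Cγ³ ≤ 2(1 − √θ)²`**: if g_0 < g′_0 then for every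
j < K, `√θ·(1∕g_j² − 1∕g′_j²) ≤ 1∕g_{j+1}² − 1∕g′_{j+1}²` — the discrepancy cannot contract faster than √θ per step.  (`sep_geometric_ratio` at ρ = √θ:
√θ∕(√θ − θ) = 1∕(1 − √θ), and (Cγ³∕2)∕(1 − √θ) ≤ 1 − √θ is the hypothesis.)  Part 7's `sep_geometric` needs 4Cγ³ ≤ (1−θ)², i.e. a box smaller by the factor
((1+√θ)²∕8)^{1∕3} in γ (`smallness_of_gen44`). [cite: Balaban1987RG1, (0.20) p.256 with p.298] -/
theorem sep_geometric_sqrt {γ θ C : ℝ} {Λ : ℕ → ℕ → ℝ} {K : ℕ} {g g' : ℕ → ℝ}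
    (hθ0 : 0 < θ) (hθ1 : θ < 1) (hC : 0 ≤ C) (hg : RGEqH K β g) (hg' : RGEqH K β g')
    (hbox : ∀ i, i ≤ K → 0 < g i ∧ g i ≤ γ) (hbox' : ∀ i, i ≤ K → 0 < g' i ∧ g' i ≤ γ)
    (hL : HistLipschitz Λ γ β) (hΛ : FadingMemory C θ Λ) (hsmall : C * γ ^ 3 ≤ 2 * (1 - Real.sqrt θ) ^ 2)
    (h0 : g 0 < g' 0) :
    ∀ j, j < K → Real.sqrt θ * (1 / (g j) ^ 2 - 1 / (g' j) ^ 2) ≤ 1 / (g (j + 1)) ^ 2 - 1 / (g' (j + 1)) ^ 2 := by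
  have hs0 : 0 < Real.sqrt θ := Real.sqrt_pos.mpr hθ0
  have hs1 : Real.sqrt θ < 1 := by
    rw [← Real.sqrt_one]; exact Real.sqrt_lt_sqrt hθ0.le hθ1
  have hsq : Real.sqrt θ * Real.sqrt θ = θ := Real.mul_self_sqrt hθ0.le
  have hθρ : θ < Real.sqrt θ := by nlinarith
  have h1s : 0 < 1 - Real.sqrt θ := by linarith
  refine sep_geometric_ratio hθ0.le hθρ hC hg hg' hbox hbox' hL hΛ ?_ h0
  have e : Real.sqrt θ / (Real.sqrt θ - θ) = 1 / (1 - Real.sqrt θ) := by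
    rw [show Real.sqrt θ - θ = Real.sqrt θ * (1 - Real.sqrt θ) by rw [mul_sub, mul_one, hsq], ← div_div,
      div_self hs0.ne']
  rw [e, mul_one_div, div_le_iff₀ h1s]
  nlinarith [hsmall]

/-- **ORDER IS PRESERVED AT EVERY SCALE IN THE SHARP BOX.**  Under the hypotheses of `sep_geometric_sqrt` (0 < θ < 1, Cγ³ ≤ 2(1 − √θ)²): g_0 < g′_0 ⟹ g_j < g′_j
for every j ≤ K.  Sign-free, AF-free, any depth; part 7's `order_preserved` in the larger box. [cite: Balaban1987RG1, (0.20) p.256 with p.298] -/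
theorem order_preserved_sqrt {γ θ C : ℝ} {Λ : ℕ → ℕ → ℝ} {K : ℕ} {g g' : ℕ → ℝ}
    (hθ0 : 0 < θ) (hθ1 : θ < 1) (hC : 0 ≤ C) (hg : RGEqH K β g) (hg' : RGEqH K β g')
    (hbox : ∀ i, i ≤ K → 0 < g i ∧ g i ≤ γ) (hbox' : ∀ i, i ≤ K → 0 < g' i ∧ g' i ≤ γ)
    (hL : HistLipschitz Λ γ β) (hΛ : FadingMemory C θ Λ) (hsmall : C * γ ^ 3 ≤ 2 * (1 - Real.sqrt θ) ^ 2)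
    (h0 : g 0 < g' 0) : ∀ j, j ≤ K → g j < g' j :=
  order_of_ratio (Real.sqrt_pos.mpr hθ0) (fun i hi => (hbox i hi).1) (fun i hi => (hbox' i hi).1) h0
    (sep_geometric_sqrt hθ0 hθ1 hC hg hg' hbox hbox' hL hΛ hsmall h0)

/-- **SAME-LENGTH UNIQUENESS, SIGN-FREE AND AF-FREE, IN THE SHARP BOX.**  Two runs of (0.20) of the SAME length K for one history-dependent β, couplings in
]0, γ], PINNED at g_K = g′_K, moduli `HistLipschitz Λ γ β` with `FadingMemory C θ Λ` (0 < θ < 1, 0 ≤ C) and `Cγ³ ≤ 2(1 − √θ)²`: the runs coincide at every scale.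
Part 7's `runs_eq_of_fadingMemory_signFree` in the larger box; prover 1's `runs_eq_of_fadingMemory` (#61e) without its AF letter. [cite: Balaban1987RG1, Thm 2 p.259 («g₀ = g₀(ε, g)») with (0.20) p.256 and p.298] -/
theorem runs_eq_of_fadingMemory_sqrt {γ θ C : ℝ} {Λ : ℕ → ℕ → ℝ} {K : ℕ} {g g' : ℕ → ℝ}
    (hθ0 : 0 < θ) (hθ1 : θ < 1) (hC : 0 ≤ C) (hg : RGEqH K β g) (hg' : RGEqH K β g')
    (hbox : ∀ i, i ≤ K → 0 < g i ∧ g i ≤ γ) (hbox' : ∀ i, i ≤ K → 0 < g' i ∧ g' i ≤ γ)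
    (hL : HistLipschitz Λ γ β) (hΛ : FadingMemory C θ Λ) (hsmall : C * γ ^ 3 ≤ 2 * (1 - Real.sqrt θ) ^ 2)
    (hpin : g K = g' K) : ∀ j, j ≤ K → g j = g' j :=
  runs_eq_of_ratio hg hg' hbox hbox'
    (fun _ _ hh hh' hb hb' hlt => order_preserved_sqrt hθ0 hθ1 hC hh hh' hb hb' hL hΛ hsmall hlt) hpin

/-- **JUNCTION WITH NODE U2 — THE SAME BOX FROM THE BACKWARD WEIGHTED MAXIMUM.**  `T4TwoRunUniqueness.eq_of_pin_fadingMemory_rho` (regime (i): pinned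
same-length runs coincide when (Cγ³∕2)ρ < (1 − ρθ)(ρ − 1) for some 1 < ρ < 1∕θ) read at ρ = 1∕√θ: (Cγ³∕2)∕√θ < (1 − √θ)(1∕√θ − 1) ⟺ Cγ³ < 2(1 − √θ)².  So for
UNIQUENESS the sharp box is node U2's (strict form); `runs_eq_of_fadingMemory_sqrt` re-derives it (non-strict) from ORDER. [cite: Balaban1987RG1, Thm 2 p.259 («g₀ = g₀(ε, g)») with (0.20) p.256 and p.298] -/
theorem runs_eq_of_fadingMemory_sqrt_U2 {γ θ C : ℝ} {Λ : ℕ → ℕ → ℝ} {K : ℕ} {g g' : ℕ → ℝ}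
    (hθ0 : 0 < θ) (hθ1 : θ < 1) (hg : RGEqH K β g) (hg' : RGEqH K β g')
    (hbox : ∀ i, i ≤ K → 0 < g i ∧ g i ≤ γ) (hbox' : ∀ i, i ≤ K → 0 < g' i ∧ g' i ≤ γ)
    (hL : HistLipschitz Λ γ β) (hΛ : FadingMemory C θ Λ) (hsmall : C * γ ^ 3 < 2 * (1 - Real.sqrt θ) ^ 2)
    (hpin : g K = g' K) : ∀ j, j ≤ K → g j = g' j := by
  have hs0 : 0 < Real.sqrt θ := Real.sqrt_pos.mpr hθ0
  have hs1 : Real.sqrt θ < 1 := by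
    rw [← Real.sqrt_one]; exact Real.sqrt_lt_sqrt hθ0.le hθ1
  have hsq : Real.sqrt θ * Real.sqrt θ = θ := Real.mul_self_sqrt hθ0.le
  have hρ1 : 1 < 1 / Real.sqrt θ := by rw [lt_div_iff₀ hs0]; linarith
  have e0 : 1 / Real.sqrt θ * θ = Real.sqrt θ := by
    rw [div_mul_eq_mul_div, one_mul, div_eq_iff hs0.ne']; exact hsq.symm
  have hρθ : 1 / Real.sqrt θ * θ < 1 := by rw [e0]; exact hs1
  refine eq_of_pin_fadingMemory_rho hθ0.le hρ1 hρθ ?_ hg hg' hbox hbox' hpin hL hΛ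
  have e2 : 1 / Real.sqrt θ - 1 = (1 - Real.sqrt θ) / Real.sqrt θ := by
    field_simp
  rw [e0, e2, show C * γ ^ 3 / 2 * (1 / Real.sqrt θ) = (C * γ ^ 3 / 2) / Real.sqrt θ by ring,
    show (1 - Real.sqrt θ) * ((1 - Real.sqrt θ) / Real.sqrt θ) = ((1 - Real.sqrt θ) * (1 - Real.sqrt θ)) / Real.sqrt θ by ring]
  exact div_lt_div_of_pos_right (by nlinarith [hsmall]) hs0

/-- **THE ENDPOINT MAP IS STRICTLY INCREASING IN THE SHARP BOX**: for two in-box runs of the same length, g_0 < g′_0 ⟺ g_K < g′_K.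
[cite: Balaban1987RG1, Thm 2 p.259 («g₀ = g₀(ε, g)») with (0.20) p.256 and p.298] -/
theorem bare_lt_iff_end_lt_sqrt {γ θ C : ℝ} {Λ : ℕ → ℕ → ℝ} {K : ℕ} {g g' : ℕ → ℝ}
    (hθ0 : 0 < θ) (hθ1 : θ < 1) (hC : 0 ≤ C) (hg : RGEqH K β g) (hg' : RGEqH K β g')
    (hbox : ∀ i, i ≤ K → 0 < g i ∧ g i ≤ γ) (hbox' : ∀ i, i ≤ K → 0 < g' i ∧ g' i ≤ γ)
    (hL : HistLipschitz Λ γ β) (hΛ : FadingMemory C θ Λ) (hsmall : C * γ ^ 3 ≤ 2 * (1 - Real.sqrt θ) ^ 2) :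
    g 0 < g' 0 ↔ g K < g' K := by
  refine ⟨fun h => order_preserved_sqrt hθ0 hθ1 hC hg hg' hbox hbox' hL hΛ hsmall h K le_rfl, fun h => ?_⟩
  rcases lt_trichotomy (g 0) (g' 0) with hlt | heq | hgt
  · exact hlt
  · exact absurd (fwd_unique hg hg' (fun i hi => (hbox i hi).1) (fun i hi => (hbox' i hi).1) heq K le_rfl) (ne_of_lt h)
  · exact absurd h (not_lt.mpr (order_preserved_sqrt hθ0 hθ1 hC hg' hg hbox' hbox hL hΛ hsmall hgt K le_rfl).le)

/-- **THE MARKOV EDGE — RATIO 1 − Cγ³∕2 AT θ = 0.**  With LAST-ONLY fading (`FadingMemory C 0 Λ`: Λ k i = 0 for i < k, Λ k k ≤ C) and `Cγ³ < 2`, two same-length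
in-]0, γ] runs of (0.20) with g_0 < g′_0 satisfy `(1 − Cγ³∕2)·(1∕g_j² − 1∕g′_j²) ≤ 1∕g_{j+1}² − 1∕g′_{j+1}²` for j < K (`sep_geometric_ratio` at θ = 0, ρ = 1 − Cγ³∕2 > 0).
Cγ³ = 2 is where the one-step chart map x ↦ x − β_{k+1}(x^{−1∕2}) may stop increasing (slope ≥ 1 − Cγ³∕2): row U's Markov FOLD threshold, at which prover 1's
`no_threshold_without_reference` families fold (#63d: Cγ³ = 6 > 2). [cite: Balaban1987RG1, (0.20) p.256 with §1 p.264] -/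
theorem sep_geometric_markov {γ C : ℝ} {Λ : ℕ → ℕ → ℝ} {K : ℕ} {g g' : ℕ → ℝ}
    (hC : 0 ≤ C) (hg : RGEqH K β g) (hg' : RGEqH K β g')
    (hbox : ∀ i, i ≤ K → 0 < g i ∧ g i ≤ γ) (hbox' : ∀ i, i ≤ K → 0 < g' i ∧ g' i ≤ γ)
    (hL : HistLipschitz Λ γ β) (hΛ : FadingMemory C 0 Λ) (hsmall : C * γ ^ 3 < 2) (h0 : g 0 < g' 0) :
    ∀ j, j < K → (1 - C * γ ^ 3 / 2) * (1 / (g j) ^ 2 - 1 / (g' j) ^ 2) ≤ 1 / (g (j + 1)) ^ 2 - 1 / (g' (j + 1)) ^ 2 := by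
  have hρ : (0 : ℝ) < 1 - C * γ ^ 3 / 2 := by linarith
  refine sep_geometric_ratio le_rfl hρ hC hg hg' hbox hbox' hL hΛ ?_ h0
  rw [sub_zero, div_self hρ.ne', mul_one]
  linarith

/-- **ORDER AT THE MARKOV EDGE**: last-only fading (`FadingMemory C 0 Λ`), `Cγ³ < 2` ⟹ g_0 < g′_0 ⟹ g_j < g′_j for every j ≤ K — part 7 had 4Cγ³ ≤ 1 at θ = 0.
[cite: Balaban1987RG1, (0.20) p.256 with §1 p.264] -/
theorem order_preserved_markov {γ C : ℝ} {Λ : ℕ → ℕ → ℝ} {K : ℕ} {g g' : ℕ → ℝ}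
    (hC : 0 ≤ C) (hg : RGEqH K β g) (hg' : RGEqH K β g')
    (hbox : ∀ i, i ≤ K → 0 < g i ∧ g i ≤ γ) (hbox' : ∀ i, i ≤ K → 0 < g' i ∧ g' i ≤ γ)
    (hL : HistLipschitz Λ γ β) (hΛ : FadingMemory C 0 Λ) (hsmall : C * γ ^ 3 < 2) (h0 : g 0 < g' 0) :
    ∀ j, j ≤ K → g j < g' j :=
  order_of_ratio (by linarith : (0 : ℝ) < 1 - C * γ ^ 3 / 2) (fun i hi => (hbox i hi).1) (fun i hi => (hbox' i hi).1) h0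
    (sep_geometric_markov hC hg hg' hbox hbox' hL hΛ hsmall h0)

/-- **PART 7's BOX LIES INSIDE THE SHARP BOX**: for 0 ≤ θ ≤ 1, `4Cγ³ ≤ (1 − θ)²` implies `Cγ³ ≤ 2(1 − √θ)²` — indeed (1−θ)² = (1−√θ)²(1+√θ)² ≤ 4(1−√θ)², so
(1−θ)²∕4 ≤ (1−√θ)² ≤ 2(1−√θ)²: every consumer of part 7's `sep_geometric` ∕ `order_preserved` ∕ `runs_eq_of_fadingMemory_signFree` upgrades by name (for θ > 0;
θ = 0 is `…_markov`). [folklore] -/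
theorem smallness_of_gen44 {γ θ C : ℝ} (hθ0 : 0 ≤ θ) (hθ1 : θ ≤ 1) (h : 4 * C * γ ^ 3 ≤ (1 - θ) ^ 2) :
    C * γ ^ 3 ≤ 2 * (1 - Real.sqrt θ) ^ 2 := by
  have hs0 : 0 ≤ Real.sqrt θ := Real.sqrt_nonneg θ
  have hs1 : Real.sqrt θ ≤ 1 := by rw [← Real.sqrt_one]; exact Real.sqrt_le_sqrt hθ1
  have hsq : Real.sqrt θ ^ 2 = θ := Real.sq_sqrt hθ0
  rw [← hsq] at h
  have h8 : 0 ≤ 8 - (1 + Real.sqrt θ) ^ 2 := by nlinarith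
  nlinarith [h, mul_nonneg (sq_nonneg (1 - Real.sqrt θ)) h8]

end General

end

end Summit.QuantumFields.BalabanUV.Beta.EriceFlowEnclosureB12AsPrintedPointwiseFadingOrderSharp
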